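import Mathlib
import Summits.Ventures.PercRepro2.CoinOrTailAlg
import Summits.Ventures.PercRepro2.CoinOrTailKDefs
import Summits.Ventures.PercRepro2.CoinOrTailKSums
import Summits.Ventures.PercRepro2.CoinOrTailKAlg
import Summits.Ventures.PercRepro2.CoinK2HeadBlindVals

/-!
# Ahlswede–Daykin steps with state × block indicators, and the Holley step of the gate over the
`R`-law at an entered cluster (blind cell PercRepro2, night-2 g13; proofs/NIGHT2-DARC.md §48)

`ad_indicator`: four nonnegative weights `G₁ … G₄` and four nonnegative indicators `I₁ … I₄` on
`U.powerset` with the lattice condition on the indicators and the weight condition wherever the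
indicator product is nonzero give `(Σ G₁I₁)(Σ G₂I₂) ≤ (Σ G₃I₃)(Σ G₄I₄)` (the four functions
theorem).  The indicator conditions needed for the head-aware two-entry theorem are the lemmas
`ind_*`; the weight conditions are the log-supermodularity of `ν · rValK` and `ν · gValK`, the
relation `gValK · gValK ≤ rValK(∩) · gValK(∪)` of the tree, and `rValK_mul_gValK_le_of_entry`:
`rValK s · gValK t ≤ rValK (s ∩ t) · gValK (s ∪ t)` whenever `t` contains an entry (sure coins) —
the gate is Holley-above the `R`-law from the entered clusters.
-/

namespace Summit.Ventures.PercRepro2.Coin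

open Classical

section ADIndicator

variable {V : Type*} [DecidableEq V] {R : Type*} [Field R] [LinearOrder R] [IsStrictOrderedRing R]

/-- **The four functions theorem on `U.powerset` with indicator-weighted functions.** -/
theorem ad_indicator (U : Finset V) (G₁ G₂ G₃ G₄ I₁ I₂ I₃ I₄ : Finset V → R)
    (hG₁ : ∀ W, 0 ≤ G₁ W) (hG₂ : ∀ W, 0 ≤ G₂ W) (hG₃ : ∀ W, 0 ≤ G₃ W) (hG₄ : ∀ W, 0 ≤ G₄ W)
    (hI₁ : ∀ W, 0 ≤ I₁ W) (hI₂ : ∀ W, 0 ≤ I₂ W) (hI₃ : ∀ W, 0 ≤ I₃ W) (hI₄ : ∀ W, 0 ≤ I₄ W)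
    (hI : ∀ s t, I₁ s * I₂ t ≤ I₃ (s ∩ t) * I₄ (s ∪ t))
    (hG : ∀ s ⊆ U, ∀ t ⊆ U, I₁ s * I₂ t ≠ 0 → G₁ s * G₂ t ≤ G₃ (s ∩ t) * G₄ (s ∪ t)) :
    (∑ W ∈ U.powerset, G₁ W * I₁ W) * (∑ W ∈ U.powerset, G₂ W * I₂ W) ≤
      (∑ W ∈ U.powerset, G₃ W * I₃ W) * (∑ W ∈ U.powerset, G₄ W * I₄ W) := by
  have g₁ : (0 : Finset V → R) ≤ fun W => G₁ W * I₁ W := fun W => mul_nonneg (hG₁ W) (hI₁ W)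
  have g₂ : (0 : Finset V → R) ≤ fun W => G₂ W * I₂ W := fun W => mul_nonneg (hG₂ W) (hI₂ W)
  have g₃ : (0 : Finset V → R) ≤ fun W => G₃ W * I₃ W := fun W => mul_nonneg (hG₃ W) (hI₃ W)
  have g₄ : (0 : Finset V → R) ≤ fun W => G₄ W * I₄ W := fun W => mul_nonneg (hG₄ W) (hI₄ W)
  have hh : ∀ ⦃s : Finset V⦄, s ⊆ U → ∀ ⦃t : Finset V⦄, t ⊆ U →
      (fun W => G₁ W * I₁ W) s * (fun W => G₂ W * I₂ W) t ≤
      (fun W => G₃ W * I₃ W) (s ∩ t) * (fun W => G₄ W * I₄ W) (s ∪ t) := by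
    intro s hs t ht
    simp only
    by_cases hz : I₁ s * I₂ t = 0
    · have e : G₁ s * I₁ s * (G₂ t * I₂ t) = (G₁ s * G₂ t) * (I₁ s * I₂ t) := by ring
      rw [e, hz, mul_zero]
      exact mul_nonneg (mul_nonneg (hG₃ _) (hI₃ _)) (mul_nonneg (hG₄ _) (hI₄ _))
    · calc G₁ s * I₁ s * (G₂ t * I₂ t) = (G₁ s * G₂ t) * (I₁ s * I₂ t) := by ring
        _ ≤ (G₃ (s ∩ t) * G₄ (s ∪ t)) * (I₃ (s ∩ t) * I₄ (s ∪ t)) := by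
          apply mul_le_mul (hG s hs t ht hz) (hI s t)
          · exact mul_nonneg (hI₁ _) (hI₂ _)
          · exact mul_nonneg (hG₃ _) (hG₄ _)
        _ = G₃ (s ∩ t) * I₃ (s ∩ t) * (G₄ (s ∪ t) * I₄ (s ∪ t)) := by ring
  have key := Finset.four_functions_theorem U g₁ g₂ g₃ g₄ hh
    (𝒜 := U.powerset) (ℬ := U.powerset) le_rfl le_rfl
  simpa only [Finset.powerset_infs_powerset_self, Finset.powerset_sups_powerset_self] using key

/-- `mWt · true` is monotone. -/
lemma mWt_true_le_union (p : V) (s t : Finset V) :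
    mWt (R := R) p true s ≤ mWt p true (s ∪ t) := by
  unfold mWt
  by_cases hs : p ∈ s <;> by_cases ht : p ∈ t <;> simp [hs, ht, Finset.mem_union]

/-- `mWt · true` is monotone (right union). -/
lemma mWt_true_le_union' (p : V) (s t : Finset V) :
    mWt (R := R) p true t ≤ mWt p true (s ∪ t) := by
  unfold mWt
  by_cases hs : p ∈ s <;> by_cases ht : p ∈ t <;> simp [hs, ht, Finset.mem_union]

/-- `mWt · false` is antitone. -/
lemma mWt_false_le_inter (p : V) (s t : Finset V) :
    mWt (R := R) p false s ≤ mWt p false (s ∩ t) := by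
  unfold mWt
  by_cases hs : p ∈ s <;> by_cases ht : p ∈ t <;> simp [hs, ht, Finset.mem_inter]

/-- Indicator step for the within-state covariance and the within-state tilt: the state cell
`e` on both sides, a marker on the first factor lands in the union. -/
lemma ind_state_marker (r₁ r₂ m : V) (e₁ e₂ : Bool) (s t : Finset V) :
    cellWt (R := R) r₁ r₂ e₁ e₂ s * mWt m true s * cellWt r₁ r₂ e₁ e₂ t ≤
      cellWt r₁ r₂ e₁ e₂ (s ∩ t) * (cellWt r₁ r₂ e₁ e₂ (s ∪ t) * mWt m true (s ∪ t)) := by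
  have h1 := cellWt_mul_le (R := R) r₁ r₂ e₁ e₂ e₁ e₂ s t
  simp only [Bool.and_self, Bool.or_self] at h1
  have h2 := mWt_true_le_union (R := R) m s t
  calc cellWt (R := R) r₁ r₂ e₁ e₂ s * mWt m true s * cellWt r₁ r₂ e₁ e₂ t
      = (cellWt r₁ r₂ e₁ e₂ s * cellWt r₁ r₂ e₁ e₂ t) * mWt m true s := by ring
    _ ≤ (cellWt r₁ r₂ e₁ e₂ (s ∩ t) * cellWt r₁ r₂ e₁ e₂ (s ∪ t)) * mWt m true (s ∪ t) :=
        mul_le_mul h1 h2 (mWt_nonneg _ _ _) (mul_nonneg (cellWt_nonneg _ _ _ _ _) (cellWt_nonneg _ _ _ _ _))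
    _ = _ := by ring

/-- Indicator step for the within-state covariance: two markers, one on each side. -/
lemma ind_state_two (r₁ r₂ m₁ m₂ : V) (e₁ e₂ : Bool) (s t : Finset V) :
    cellWt (R := R) r₁ r₂ e₁ e₂ s * mWt m₁ true s * (cellWt r₁ r₂ e₁ e₂ t * mWt m₂ true t) ≤
      cellWt r₁ r₂ e₁ e₂ (s ∩ t) *
        (cellWt r₁ r₂ e₁ e₂ (s ∪ t) * mWt m₁ true (s ∪ t) * mWt m₂ true (s ∪ t)) := by
  have h1 := cellWt_mul_le (R := R) r₁ r₂ e₁ e₂ e₁ e₂ s t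
  simp only [Bool.and_self, Bool.or_self] at h1
  have h2 := mWt_true_le_union (R := R) m₁ s t
  have h3 := mWt_true_le_union' (R := R) m₂ s t
  calc cellWt (R := R) r₁ r₂ e₁ e₂ s * mWt m₁ true s * (cellWt r₁ r₂ e₁ e₂ t * mWt m₂ true t)
      = (cellWt r₁ r₂ e₁ e₂ s * cellWt r₁ r₂ e₁ e₂ t) * (mWt m₁ true s * mWt m₂ true t) := by ring
    _ ≤ (cellWt r₁ r₂ e₁ e₂ (s ∩ t) * cellWt r₁ r₂ e₁ e₂ (s ∪ t)) *
          (mWt m₁ true (s ∪ t) * mWt m₂ true (s ∪ t)) := by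
        apply mul_le_mul h1 (mul_le_mul h2 h3 (mWt_nonneg _ _ _) (mWt_nonneg _ _ _))
        · exact mul_nonneg (mWt_nonneg _ _ _) (mWt_nonneg _ _ _)
        · exact mul_nonneg (cellWt_nonneg _ _ _ _ _) (cellWt_nonneg _ _ _ _ _)
    _ = _ := by ring

/-- Indicator step between two states `e ≤ e'` of the state lattice: a marker on the lower
state's factor lands in the union. -/
lemma ind_two_states (r₁ r₂ m : V) (e₁ e₂ e₁' e₂' : Bool) (s t : Finset V) :
    cellWt (R := R) r₁ r₂ e₁ e₂ s * mWt m true s * cellWt r₁ r₂ e₁' e₂' t ≤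
      cellWt r₁ r₂ (e₁ && e₁') (e₂ && e₂') (s ∩ t) *
        (cellWt r₁ r₂ (e₁ || e₁') (e₂ || e₂') (s ∪ t) * mWt m true (s ∪ t)) := by
  have h1 := cellWt_mul_le (R := R) r₁ r₂ e₁ e₂ e₁' e₂' s t
  have h2 := mWt_true_le_union (R := R) m s t
  calc cellWt (R := R) r₁ r₂ e₁ e₂ s * mWt m true s * cellWt r₁ r₂ e₁' e₂' t
      = (cellWt r₁ r₂ e₁ e₂ s * cellWt r₁ r₂ e₁' e₂' t) * mWt m true s := by ring
    _ ≤ (cellWt r₁ r₂ (e₁ && e₁') (e₂ && e₂') (s ∩ t) *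
          cellWt r₁ r₂ (e₁ || e₁') (e₂ || e₂') (s ∪ t)) * mWt m true (s ∪ t) :=
        mul_le_mul h1 h2 (mWt_nonneg _ _ _) (mul_nonneg (cellWt_nonneg _ _ _ _ _) (cellWt_nonneg _ _ _ _ _))
    _ = _ := by ring

/-- Indicator step for the filter mean ordering: an entry on the first factor and a marker on
the second both land in the union. -/
lemma ind_filter (r m : V) (s t : Finset V) :
    mWt (R := R) r true s * mWt m true t ≤ 1 * (mWt r true (s ∪ t) * mWt m true (s ∪ t)) := by
  rw [one_mul]
  exact mul_le_mul (mWt_true_le_union r s t) (mWt_true_le_union' m s t) (mWt_nonneg _ _ _)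
    (mWt_nonneg _ _ _)

/-- Indicator step for the top mean ordering: the top state is monotone. -/
lemma ind_top (r₁ r₂ m : V) (s t : Finset V) :
    cellWt (R := R) r₁ r₂ true true s * mWt m true t ≤
      1 * (cellWt r₁ r₂ true true (s ∪ t) * mWt m true (s ∪ t)) := by
  rw [one_mul]
  have h1 : cellWt (R := R) r₁ r₂ true true s ≤ cellWt r₁ r₂ true true (s ∪ t) := by
    unfold cellWt
    exact mul_le_mul (mWt_true_le_union _ _ _) (mWt_true_le_union _ _ _) (mWt_nonneg _ _ _)
      (mWt_nonneg _ _ _)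
  exact mul_le_mul h1 (mWt_true_le_union' m s t) (mWt_nonneg _ _ _) (cellWt_nonneg _ _ _ _ _)

/-- Indicator step for the ideal mean ordering: the entry-free state is antitone. -/
lemma ind_ideal (r₁ r₂ m : V) (s t : Finset V) :
    cellWt (R := R) r₁ r₂ false false s * mWt m true s * 1 ≤
      cellWt r₁ r₂ false false (s ∩ t) * mWt m true (s ∪ t) := by
  rw [mul_one]
  have h1 : cellWt (R := R) r₁ r₂ false false s ≤ cellWt r₁ r₂ false false (s ∩ t) := by
    unfold cellWt
    exact mul_le_mul (mWt_false_le_inter _ _ _) (mWt_false_le_inter _ _ _) (mWt_nonneg _ _ _)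
      (mWt_nonneg _ _ _)
  exact mul_le_mul h1 (mWt_true_le_union m s t) (mWt_nonneg _ _ _) (cellWt_nonneg _ _ _ _ _)

end ADIndicator

section HolleyStep

variable {V : Type*} {E : Type*} [Fintype V] [DecidableEq V] {R : Type*} [Field R] [LinearOrder R]
  [IsStrictOrderedRing R]

omit [Fintype V] [LinearOrder R] [IsStrictOrderedRing R] in
/-- With sure coins the `R`-value of a cluster is the head value of `s` or of `s ∪ {a}`. -/
lemma rValK_sure_eq (A : Finset V → R) (pr : E → R) {ent : Finset V} (c : V → E) (a : V)
    (hsure : ∀ r ∈ ent, pr (c r) = 1) (s : Finset V) :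
    rValK A pr ent c a s = A (if ∃ r ∈ ent, r ∈ s then s ∪ {a} else s) := by
  split_ifs with h
  · exact rValK_sure_of_entry A pr c a hsure h
  · exact rValK_of_no_entry A pr c a (fun r hr hrs => h ⟨r, hr, hrs⟩)

omit [Fintype V] in
/-- **The Holley step of the gate over the `R`-law at an entered cluster** (sure coins):
`rValK s · gValK t ≤ rValK (s ∩ t) · gValK (s ∪ t)` whenever `t` contains an entry. -/
theorem rValK_mul_gValK_le_of_entry (A : Finset V → R) (pr : E → R) {ent : Finset V} (c : V → E)
    (a w : V) (hsure : ∀ r ∈ ent, pr (c r) = 1) (hA0 : ∀ W, 0 ≤ A W)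
    (hA : ∀ s t : Finset V, A s * A t ≤ A (s ∩ t) * A (s ∪ t))
    (hmono : ∀ s t : Finset V, s ⊆ t → A t ≤ A s) {s t : Finset V} (ht : ∃ r ∈ ent, r ∈ t) :
    rValK A pr ent c a s * gValK A pr ent c a w t ≤
      rValK A pr ent c a (s ∩ t) * gValK A pr ent c a w (s ∪ t) := by
  have hst : ∃ r ∈ ent, r ∈ s ∪ t := by
    obtain ⟨r, hr, hrt⟩ := ht
    exact ⟨r, hr, Finset.mem_union_right _ hrt⟩
  rw [gValK_sure_of_entry A pr c a w hsure ht, gValK_sure_of_entry A pr c a w hsure hst,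
    rValK_sure_eq A pr c a hsure s, rValK_sure_eq A pr c a hsure (s ∩ t)]
  -- the `R`-argument of `s` and of `s ∩ t`
  set X := (if ∃ r ∈ ent, r ∈ s then s ∪ {a} else s) with hX
  set Y := (if ∃ r ∈ ent, r ∈ s ∩ t then (s ∩ t) ∪ {a} else s ∩ t) with hY
  have hXsub : s ⊆ X := by
    rw [hX]; split_ifs
    · exact Finset.subset_union_left
    · exact le_rfl
  have hXsup : X ⊆ s ∪ {a} := by
    rw [hX]; split_ifs
    · exact le_rfl
    · exact Finset.subset_union_left
  have hYsub : Y ⊆ X ∩ (t ∪ {a, w}) := by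
    intro x hx
    rw [hY] at hx
    rw [Finset.mem_inter, Finset.mem_union]
    split_ifs at hx with hh
    · rw [Finset.mem_union, Finset.mem_inter, Finset.mem_singleton] at hx
      rcases hx with ⟨hxs, hxt⟩ | rfl
      · exact ⟨hXsub hxs, Or.inl hxt⟩
      · have hsent : ∃ r ∈ ent, r ∈ s := by
          obtain ⟨r, hr, hr'⟩ := hh
          exact ⟨r, hr, (Finset.mem_inter.1 hr').1⟩
        refine ⟨?_, Or.inr (by simp)⟩
        rw [hX, if_pos hsent]
        exact Finset.mem_union_right _ (Finset.mem_singleton_self _)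
    · rw [Finset.mem_inter] at hx
      exact ⟨hXsub hx.1, Or.inl hx.2⟩
  have hU1 : s ∪ t ∪ {a, w} ⊆ X ∪ (t ∪ {a, w}) := by
    intro x hx
    rw [Finset.mem_union, Finset.mem_union] at hx
    rw [Finset.mem_union, Finset.mem_union]
    rcases hx with (hxs | hxt) | hxaw
    · exact Or.inl (hXsub hxs)
    · exact Or.inr (Or.inl hxt)
    · exact Or.inr (Or.inr hxaw)
  have hU2 : X ∪ (t ∪ {a, w}) ⊆ s ∪ t ∪ {a, w} := by
    intro x hx
    rw [Finset.mem_union, Finset.mem_union] at hx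
    rw [Finset.mem_union, Finset.mem_union]
    rcases hx with hxX | (hxt | hxaw)
    · have := hXsup hxX
      rw [Finset.mem_union, Finset.mem_singleton] at this
      rcases this with hxs | rfl
      · exact Or.inl (Or.inl hxs)
      · exact Or.inr (by simp)
    · exact Or.inl (Or.inr hxt)
    · exact Or.inr hxaw
  have e1 : A (X ∪ (t ∪ {a, w})) = A (s ∪ t ∪ {a, w}) :=
    le_antisymm (hmono _ _ hU1) (hmono _ _ hU2)
  calc A X * A (t ∪ {a, w}) ≤ A (X ∩ (t ∪ {a, w})) * A (X ∪ (t ∪ {a, w})) := hA _ _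
    _ ≤ A Y * A (s ∪ t ∪ {a, w}) := by
        rw [e1]
        exact mul_le_mul_of_nonneg_right (hmono _ _ hYsub) (hA0 _)

end HolleyStep

end Summit.Ventures.PercRepro2.Coin
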